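import Summits.BirchSwinnertonDyer.BirchSwinnertonDyer.Theorems.GenusKolyvaginAtTwoGenusPrimitiveSupplyAtTwoPosDiscShallowArchimedeanBit
import Summits.BirchSwinnertonDyer.BirchSwinnertonDyer.Theorems.GenusKolyvaginAtTwoGenusDeepSupplyAtTwoNegDiscNarrowDepthZeroAntiInvariantRational
import Summits.BirchSwinnertonDyer.BirchSwinnertonDyer.Theorems.GenusKolyvaginAtTwoGenusDeepSupplyAtTwoNegDiscNarrowDepthZeroInstance
import HarnessLib

/-!
# The archimedean bit at the level of POINTS: the twin point of an anti-invariant class lies ON THE EGG (`Δ > 0` cell)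

Helper file for the `Δ > 0` supply crux `GenusPrimitiveSupplyAtTwoPosDiscShallow` (item `stmt-BirchSwinnertonDyer-25504`) of route
`GenusKolyvaginAtTwo`, namespace `…GenusSupplyNarrow.ArchBit`.  It refines the Selmer-level archimedean bit of
`…PosDiscShallowArchimedeanBit` (the non-trivial `2`-Selmer class of the all-silent twin is NON-strict at `∞`) to the level of
rational points of the twist `T = E^{(d_K)}`:

* §1 (any `V/ℚ` with `Δ_V > 0`, `V(ℚ)[2] = 0`): a rational point `P = (x, y)` whose Kummer class is non-trivial at the real place lies
  ON THE EGG (`onEgg_of_localization_real_kummerMapTorsion_ne_zero`); a point of `2V(ℚ)` lies OFF the egg (`not_onEgg_of_two_smul_eq`).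
* §2 (the `K₁⁺` cell: `Δ_E > 0`, `ρ̄_{E,2}` onto, `C(E)` odd, `#Sel₂(E) = 1`, `K` imaginary quadratic with odd `d_K`, Heegner, `2` split,
  all-silent twin `ord₂ C(E^{(d_K)}) = 0`): for every ANTI-invariant `Y ∈ E(K)` (`τY = −Y`) with NO half in `E(K)`, the twin point
  `z ∈ T(ℚ)` of `Y` (`F z̃ = e_* Y` under a signed twist isomorphism `F : T(ℚ̄) ≃ E(ℚ̄)`) is an affine point ON THE EGG of `T`
  (`exists_twin_point_onEgg_of_anti_of_not_exists_two_smul`): its Kummer class is a non-zero element of `Sel₂(T)`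
  (`DepthZero.kummer_ne_zero_of_no_rational_half`), hence non-trivial at `∞` by the Selmer-level bit
  (`twin_selmer_eq_zero_of_localization_real_eq_zero`), hence `z ∉ 2T(ℝ)`, i.e. `z` is on the egg (§1).
* §4 (crux currency, `K₁⁺` cell with `w(E) = +1` and first Kolyvagin datum `d₁`): if `y_K = P(1) ∉ 2E(K[1])` (`M₀ = 0`) then, with
  `P₀ ↦ P(1)` the basic Heegner point and `s₀` the rational torsion correction (`2s₀ = τP₀ + P₀`, Gross 5.3), the anti-invariant point
  `Y = P₀ − s₀` has no half in `E(K)` and its twin point — the TWIN HEEGNER POINT — lies ON THE EGG of `E^{(d_K)}`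
  (`exists_twinHeegnerPoint_onEgg_of_not_two_dvd_derivedPoint`); conversely if `y_K ∈ 2E(K[1])` (`1 ≤ M₀`) the twin Heegner point
  lies OFF the egg (`not_onEgg_twinHeegnerPoint_of_two_dvd_derivedPoint`, McCallum descent + §3): «`M₀ = 0` ⟺ twin Heegner point on
  the egg».
* §3 (converse, any quadratic `K` with `E(K)[2] = 0`): if `Y = 2Q` in `E(K)` then the twin point of `Y` is twice the twin point of `Q`, hence
  OFF the egg (`not_onEgg_twin_point_of_two_smul_eq`).

Reading for the instrument (memo `R1POS-VACUOUS-gk2p5-g34.md` §3): with `Y = P₀ − s₀` (`P₀ ↦ P(1)` the basic Heegner point, `s₀` the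
rational torsion correction of `DepthZero.reductionBit_of_not_two_dvd_derivedPoint_prime`), «`M₀ = 0` ⟺ the twin Heegner point lies on
the egg of `E^{(d_K)}`» — the `Δ > 0` replacement of the (vacuous, `…ReductionBitFrameEmpty`) reduction bit `R₁⁺`.

BSD is not proved here; nothing in this file closes an item.
-/

open scoped Classical

set_option linter.dupNamespace false -- `Summit.<P>.<Sub>` repeats `BirchSwinnertonDyer` (D-0017)

namespace Summit.BirchSwinnertonDyer.BirchSwinnertonDyer.Theorems.GenusSupplyNarrow.ArchBit

open WeierstrassCurve Field NumberField IsDedekindDomain Function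
open Literature.NumberTheory.EllipticCurves Literature.NumberTheory.GaloisRepresentations
open Literature.NumberTheory.GaloisCohomology
open Summit.BirchSwinnertonDyer.Rank1Residual.F1Sign2 (OnEgg NoRationalTwoTorsion)
open Summit.BirchSwinnertonDyer.Rank1Residual.F1Sign2.EggDoubling (psiTwo psiTwo_ne_zero)
open Summit.BirchSwinnertonDyer.BirchSwinnertonDyer.Theorems.GenusKolyArch
open Summit.BirchSwinnertonDyer.BirchSwinnertonDyer.Theorems.GenusKolyTwistLocal
open Summit.BirchSwinnertonDyer.BirchSwinnertonDyer.Theorems.GenusExact.PlusDescent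

/-! ## §1 Pointwise egg lemmas over `ℚ` -/

section Pointwise

variable (V : WeierstrassCurve ℚ) [V.IsElliptic]

/-- **A rational point whose Kummer class is non-trivial at `∞` lies ON THE EGG** (`Δ_V > 0`, `V(ℚ)[2] = 0`): otherwise `ψ₂(x) ≠ 0` and
`P` is off the egg, so `P_∞ ∈ 2V(ℝ)` (`exists_add_self_eq_baseChange_of_not_onEgg`) and `loc_∞ κ(P) = κ_∞(P_∞) = 0`.
[cite: Kramer1981, §2 Prop. 6 (p. 127)] [cite: SilvermanAEC2009, X.§4 diagram (**)] -/
theorem onEgg_of_localization_real_kummerMapTorsion_ne_zero (hΔ : 0 < V.Δ) (hT : NoRationalTwoTorsion V) {x y : ℚ}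
    (hxy : V.toAffine.Nonsingular x y)
    (hne : galoisCohomology.localization (V.torsionGaloisModule ((2 : ℕ) : ℤ)) (Sum.inl Rat.infinitePlace) 1
      (kummerMapTorsion V ((2 : ℕ) : ℤ) (hdiv_two V) (.some x y hxy)) ≠ 0) :
    OnEgg V x := by
  by_contra hoff
  apply hne
  have h2 : ((2 : ℕ) : ℤ) ≠ 0 := by norm_num
  rw [localization_kummerMapTorsion_eq_zero_iff V h2 (hdiv_two V)]
  have hx : psiTwo V x ≠ 0 := psiTwo_ne_zero V hT x
  have e : Place.Completion (Sum.inl Rat.infinitePlace : Place ℚ) ≃+* ℝ :=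
    InfinitePlace.Completion.ringEquivRealOfIsReal Rat.isReal_infinitePlace
  obtain ⟨h', hP'⟩ : ∃ h', Affine.Point.baseChange (W' := V) ℚ (Place.Completion (Sum.inl Rat.infinitePlace : Place ℚ))
      (.some x y hxy) = .some (algebraMap ℚ _ x) (algebraMap ℚ _ y) h' := ⟨_, rfl⟩
  obtain ⟨Q, hQ⟩ := exists_add_self_eq_baseChange_of_not_onEgg V e hΔ hx hoff h'
  refine ⟨Q, ?_⟩
  rw [Nat.cast_ofNat, two_zsmul, hQ]
  rfl

omit [V.IsElliptic] in
/-- **A point of `2V(ℚ)` lies OFF the egg**: `2V(ℝ)` misses the egg (`not_onEgg_of_add_self_eq_real`). [cite: Kramer1981, §2 Prop. 6 (p. 127)] -/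
theorem not_onEgg_of_two_smul_eq {x y : ℚ} {hxy : V.toAffine.Nonsingular x y} (Q : V.toAffine.Point)
    (hQ : (2 : ℤ) • Q = .some x y hxy) : ¬ OnEgg V x := by
  -- base change `V(ℚ) → V(ℝ)` as a homomorphism on `V.toAffine.Point`, with its value on the affine point `(x, y)`
  obtain ⟨bc, h', hP'⟩ : ∃ (bc : V.toAffine.Point →+ (V.baseChange ℝ).toAffine.Point) (h' : _),
      bc (.some x y hxy) = .some (algebraMap ℚ ℝ x) (algebraMap ℚ ℝ y) h' :=
    ⟨Affine.Point.baseChange (W' := V) ℚ ℝ, _, rfl⟩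
  have hR : bc Q + bc Q = .some (algebraMap ℚ ℝ x) (algebraMap ℚ ℝ y) h' := by
    rw [← map_add, ← two_zsmul, hQ, hP']
  exact not_onEgg_of_add_self_eq_real V _ hR

omit [V.IsElliptic] in
/-- `ι(P + Q) = ι P + ι Q` for `V(ℚ) → V(ℚ̄)`: the `→+` structure of the generic `toGeomPoints` carries the classical `DecidableEq`
instance on `ℚ`, Mathlib's `ℚ`-points the computable one, so the generic `map_add` does not fire syntactically
(cf. `toGeomPoints_add_rat` of `PrintCFramBottomClassIndexLawFiveLeSelmerDevissageLocalCriterionIsogeny`). [folklore] -/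
theorem toGeomPoints_add_rat' (P Q : V.toAffine.Point) : toGeomPoints V (P + Q) = toGeomPoints V P + toGeomPoints V Q := by
  convert @AddMonoidHom.map_add _ _ (_) (_) (toGeomPoints V) P Q
  exact congrArg (fun d : DecidableEq ℚ ↦ @Affine.Point.instAdd ℚ _ V.toAffine d) (Subsingleton.elim _ _)

end Pointwise

/-! ## §2 The twin point of an anti-invariant class with no half lies ON THE EGG (`K₁⁺` cell) -/

section Twin

variable (W : WeierstrassCurve ℚ) [W.IsElliptic] [W.IsGloballyMinimal]

/-- **The twin point lies ON THE EGG of `T = E^{(d_K)}`** on the `K₁⁺` cell.  For an anti-invariant `Y ∈ E(K)` (`τY = −Y`) with no half in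
`E(K)`, its twin point `z ∈ T(ℚ)` (`F z̃ = e_*Y`, `F` a signed twist isomorphism) is affine, `z = (x, y)`, with `x` ON THE EGG of `T`:
`κ(z) ≠ 0` (`DepthZero.kummer_ne_zero_of_no_rational_half` + `no_rational_half_of_not_exists_two_smul`), `κ(z) ∈ Sel₂(T)`, so
`loc_∞ κ(z) ≠ 0` by the Selmer-level archimedean bit `twin_selmer_eq_zero_of_localization_real_eq_zero` (model `T = 1 • T`, all-silent:
`ord₂ C(T) = ord₂ C(Wd) = 0`), and §1 applies (`Δ_T = d_K⁶ Δ_E > 0`, `T(ℚ)[2] = 0` as `ρ̄_{T,2} = ρ̄_{E,2}` is onto).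
[cite: MazurRubin2010, Prop. 3.3, Cor. 3.4 (i)] [cite: Kramer1981, §2 Prop. 6 (p. 127)] [cite: SilvermanAEC2009, X.5 Cor. 5.4] -/
theorem exists_twin_point_onEgg_of_anti_of_not_exists_two_smul {K : Type} [Field K] [NumberField K]
    (hs2 : W.HasSurjectiveModNGaloisRep 2) (hTam : Odd W.tamagawaProduct) (h1 : Nat.card (W.selmerGroup 2) = 1)
    (hK : IsImaginaryQuadratic K) (hodd : Odd (discr K)) (hH : SatisfiesHeegnerHypothesis (W.conductorNorm ℤ) K)
    (h2K : ((Ideal.span {(2 : ℤ)}).primesOver (𝓞 K)).ncard = 2) (hpos : 0 < W.Δ) {τ : K ≃ₐ[ℚ] K} (hτ : τ ≠ 1)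
    {Wd : WeierstrassCurve ℚ} [Wd.IsElliptic] (Cd : VariableChange ℚ) (hCd : Cd • W.quadraticTwist (discr K : ℚ) = Wd)
    (hDEF : padicValNat 2 Wd.tamagawaProduct = 0)
    (F : (W.quadraticTwist (discr K : ℚ)).geomPoints ≃+ W.geomPoints)
    (hF : ∀ σ : absoluteGaloisGroup ℚ,
      (haveI : Algebra.IsQuadraticExtension ℚ K := ⟨hK.1⟩; absGaloisQuot ℚ K σ = 1) ∧ (∀ P, F (σ • P) = σ • F P) ∨
      (haveI : Algebra.IsQuadraticExtension ℚ K := ⟨hK.1⟩; absGaloisQuot ℚ K σ ≠ 1) ∧ (∀ P, F (σ • P) = -(σ • F P)))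
    {Y : (W.baseChange K).toAffine.Point} (hanti : τ • Y = -Y)
    (hY2 : ¬ ∃ Q : (W.baseChange K).toAffine.Point, (2 : ℤ) • Q = Y) :
    ∃ (x y : ℚ) (hxy : (W.quadraticTwist (discr K : ℚ)).toAffine.Nonsingular x y),
      F (toGeomPoints _ (.some x y hxy)) = Affine.Point.map (W' := W) (absEmbedding ℚ K) Y ∧
      OnEgg (W.quadraticTwist (discr K : ℚ)) x := by
  haveI : Fact (Nat.Prime 2) := ⟨Nat.prime_two⟩
  haveI : Algebra.IsQuadraticExtension ℚ K := ⟨hK.1⟩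
  haveI : IsGalois ℚ K := inferInstance
  have hd0 : (discr K : ℚ) ≠ 0 := by exact_mod_cast NumberField.discr_ne_zero K
  haveI hTell : (W.quadraticTwist (discr K : ℚ)).IsElliptic := W.isElliptic_quadraticTwist hd0
  -- the twin point `z` of `Y` and its non-zero Kummer class
  obtain ⟨z, hz⟩ := DepthZero.exists_twin_point_of_anti W hK hτ F hF hanti
  have hκ : kummerMapTorsion (W.quadraticTwist (discr K : ℚ)) ((2 : ℕ) : ℤ) (hdiv_two _) z ≠ 0 :=
    DepthZero.kummer_ne_zero_of_no_rational_half W hK F hF hz (DepthZero.no_rational_half_of_not_exists_two_smul W hY2)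
  have hsel : kummerMapTorsion (W.quadraticTwist (discr K : ℚ)) ((2 : ℕ) : ℤ) (hdiv_two _) z ∈
      ((W.quadraticTwist (discr K : ℚ)).kummerSelmerStructure ((2 : ℕ) : ℤ)).selmerGroup :=
    (SetLike.ext_iff.mp ((W.quadraticTwist (discr K : ℚ)).selmerGroup_eq_selmerGroup_kummerSelmerStructure _) _).mp
      (kummerMapTorsion_mem_selmerGroup (W.quadraticTwist (discr K : ℚ)) _ (hdiv_two _) _)
  -- `T(ℚ)[2] = 0`, `Δ_T > 0`, `ord₂ C(T) = 0` for `T = E^{(d_K)}`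
  have hsT : (W.quadraticTwist (discr K : ℚ)).HasSurjectiveModNGaloisRep ((2 : ℤ) ^ 1) := by
    rw [pow_one]
    exact (hasSurjectiveModNGaloisRep_two_quadraticTwist_iff W hd0).mpr hs2
  have hTors : NoRationalTwoTorsion (W.quadraticTwist (discr K : ℚ)) :=
    GenusKolyTwin.noRationalTwoTorsion_of_hasSurjectiveModNGaloisRep _ hsT
  have hΔT : 0 < (W.quadraticTwist (discr K : ℚ)).Δ := by
    rw [quadraticTwist_Δ]
    positivity
  have hDEFT : padicValNat 2 (W.quadraticTwist (discr K : ℚ)).tamagawaProduct = 0 := by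
    have h1T := prod_ncard_roots_add_one_eq_two_pow_padicValNat_tamagawaProduct_twin W hK hodd hH hTam
      (Wd := W.quadraticTwist (discr K : ℚ)) 1 (one_smul _ _)
    have h2T := prod_ncard_roots_add_one_eq_two_pow_padicValNat_tamagawaProduct_twin W hK hodd hH hTam Cd hCd
    have heq : padicValNat 2 (W.quadraticTwist (discr K : ℚ)).tamagawaProduct = padicValNat 2 Wd.tamagawaProduct :=
      Nat.pow_right_injective le_rfl (h1T.symm.trans h2T)
    rw [heq, hDEF]
  -- the class is non-trivial at `∞` (Selmer-level archimedean bit, model `T = 1 • T`)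
  have hne : galoisCohomology.localization ((W.quadraticTwist (discr K : ℚ)).torsionGaloisModule ((2 : ℕ) : ℤ))
      (Sum.inl Rat.infinitePlace) 1 (kummerMapTorsion (W.quadraticTwist (discr K : ℚ)) ((2 : ℕ) : ℤ) (hdiv_two _) z) ≠ 0 :=
    fun h0 ↦ hκ (twin_selmer_eq_zero_of_localization_real_eq_zero W hK hodd hH h2K hTam h1
      (Wd := W.quadraticTwist (discr K : ℚ)) 1 (one_smul _ _) hDEFT hsel h0)
  rcases z with _ | ⟨x, y, hxy⟩
  · exact absurd (map_zero (kummerMapTorsion (W.quadraticTwist (discr K : ℚ)) ((2 : ℕ) : ℤ) (hdiv_two _))) hκ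
  · exact ⟨x, y, hxy, hz, onEgg_of_localization_real_kummerMapTorsion_ne_zero _ hΔT hTors hxy hne⟩

/-! ## §3 Converse: the twin point of a class of `2E(K)` lies OFF the egg -/

omit [W.IsElliptic] [W.IsGloballyMinimal] in
/-- **The twin point of `Y = 2Q ∈ 2E(K)` lies OFF the egg** (`E(K)[2] = 0`, `K` imaginary quadratic): `Q` is anti-invariant too
(`2(τQ + Q) = τY + Y = 0`), its twin point `z'` has `F(2z̃') = e_*Y = F z̃`, so `z = 2z'` in `T(ℚ)` and `2T(ℝ)` misses the egg.
[cite: Kramer1981, §2 Prop. 6 (p. 127)] [cite: SilvermanAEC2009, X.5 Cor. 5.4] -/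
theorem not_onEgg_twin_point_of_two_smul_eq {K : Type} [Field K] [NumberField K] [(W.quadraticTwist (discr K : ℚ)).IsElliptic]
    (hK : IsImaginaryQuadratic K) {τ : K ≃ₐ[ℚ] K} (hτ : τ ≠ 1)
    (h2K : ∀ P : (W.baseChange K).toAffine.Point, (2 : ℤ) • P = 0 → P = 0)
    (F : (W.quadraticTwist (discr K : ℚ)).geomPoints ≃+ W.geomPoints)
    (hF : ∀ σ : absoluteGaloisGroup ℚ,
      (haveI : Algebra.IsQuadraticExtension ℚ K := ⟨hK.1⟩; absGaloisQuot ℚ K σ = 1) ∧ (∀ P, F (σ • P) = σ • F P) ∨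
      (haveI : Algebra.IsQuadraticExtension ℚ K := ⟨hK.1⟩; absGaloisQuot ℚ K σ ≠ 1) ∧ (∀ P, F (σ • P) = -(σ • F P)))
    {Y Q : (W.baseChange K).toAffine.Point} (hanti : τ • Y = -Y) (hQ : (2 : ℤ) • Q = Y)
    {x y : ℚ} {hxy : (W.quadraticTwist (discr K : ℚ)).toAffine.Nonsingular x y}
    (hz : F (toGeomPoints _ (.some x y hxy)) = Affine.Point.map (W' := W) (absEmbedding ℚ K) Y) :
    ¬ OnEgg (W.quadraticTwist (discr K : ℚ)) x := by
  -- `Q` is anti-invariant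
  have hsm : τ • ((2 : ℤ) • Q) = (2 : ℤ) • (τ • Q) :=
    map_zsmul (DistribSMul.toAddMonoidHom ((W.baseChange K).toAffine.Point) τ) 2 Q
  have hantiQ : τ • Q = -Q := by
    have h0 : (2 : ℤ) • (τ • Q + Q) = 0 := by
      rw [zsmul_add, ← hsm, hQ, hanti, neg_add_cancel]
    exact eq_neg_of_add_eq_zero_left (h2K _ h0)
  -- the twin point `z'` of `Q` halves `z`
  obtain ⟨z', hz'⟩ := DepthZero.exists_twin_point_of_anti W hK hτ F hF hantiQ
  have h1 : F (toGeomPoints _ ((2 : ℤ) • z')) = (2 : ℤ) • F (toGeomPoints _ z') := by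
    rw [two_zsmul, toGeomPoints_add_rat', map_add, two_zsmul]
  have hgeom : toGeomPoints _ ((2 : ℤ) • z') = toGeomPoints _ (.some x y hxy) := by
    apply F.injective
    refine h1.trans (Eq.trans ?_ hz.symm)
    rw [hz', ← hQ]
    exact (map_zsmul (Affine.Point.map (W' := W) (absEmbedding ℚ K)) (2 : ℤ) Q).symm
  exact not_onEgg_of_two_smul_eq _ z' (toGeomPoints_injective _ hgeom)

end Twin

/-! ## §4 Crux currency: on the `K₁⁺` cell with `M₀ = 0` the twin HEEGNER point lies ON THE EGG -/

section Heegner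

open Literature.NumberTheory.EllipticCurves.ModularForms

variable (W : WeierstrassCurve ℚ) [W.IsElliptic] [W.IsGloballyMinimal] [NeZero (W.conductorNorm ℤ)]

/-- **`M₀ = 0` ⟹ the twin Heegner point lies ON THE EGG of `E^{(d_K)}`** (`K₁⁺` cell: `Δ_E > 0`, `ρ̄_{E,2}` onto, `C(E)` odd,
`#Sel₂(E) = 1`, `w(E) = +1`; `K` imaginary quadratic, `d_K` odd, Heegner, `2` split; all-silent twin `ord₂ C(E^{(d_K)}) = 0`; first
Kolyvagin datum `d₁` with `y_K = P(1) ∉ 2E(K[1])`).  With `P₀ ∈ E(K)` over `P(1)` and the torsion correction `s₀` (`τs₀ = s₀`,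
`2s₀ = τP₀ + P₀` — Gross 5.3 with `w = +1`, `E(K)[2] = 0` so `τP₀ + P₀` has odd order), the point `Y = P₀ − s₀` is ANTI-invariant with no
half in `E(K)` (a half `Q` would give `y_K = 2(Q + c s₀)`), and §2 puts its twin point on the egg.  Bookkeeping adapted from
`DepthZero.reductionBit_of_not_two_dvd_derivedPoint_prime`. [cite: GrossLMS1991, §5 Prop. 5.3] [cite: MazurRubin2010, Prop. 3.3, Cor. 3.4 (i)]
[cite: Kramer1981, §2 Prop. 6 (p. 127)] -/
theorem exists_twinHeegnerPoint_onEgg_of_not_two_dvd_derivedPoint {K : Type} [Field K] [NumberField K]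
    (hpos : 0 < W.Δ) (hs2 : W.HasSurjectiveModNGaloisRep 2) (hTam : Odd W.tamagawaProduct) (h1 : Nat.card (W.selmerGroup 2) = 1)
    (hw : W.rootNumber = 1)
    (hK : IsImaginaryQuadratic K) (hodd : Odd (discr K)) (hH : SatisfiesHeegnerHypothesis (W.conductorNorm ℤ) K)
    (h2K : ((Ideal.span {(2 : ℤ)}).primesOver (𝓞 K)).ncard = 2) {τ : K ≃ₐ[ℚ] K} (hτ : τ ≠ 1)
    {Wd : WeierstrassCurve ℚ} [Wd.IsElliptic] (Cd : VariableChange ℚ) (hCd : Cd • W.quadraticTwist (discr K : ℚ) = Wd)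
    (hDEF : padicValNat 2 Wd.tamagawaProduct = 0)
    (Dt : ModularParametrizationData W (W.conductorNorm ℤ)) (β : ℤ) (ι : K →+* ℂ) (d₁ : KolyvaginHeegnerData Dt β ι 1)
    (hK1 : ¬ ∃ Q : (W.baseChange (ringClassField K ι 1)).toAffine.Point, (2 : ℤ) • Q = d₁.derivedPoint)
    (F : (W.quadraticTwist (discr K : ℚ)).geomPoints ≃+ W.geomPoints)
    (hF : ∀ σ : absoluteGaloisGroup ℚ,
      (haveI : Algebra.IsQuadraticExtension ℚ K := ⟨hK.1⟩; absGaloisQuot ℚ K σ = 1) ∧ (∀ P, F (σ • P) = σ • F P) ∨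
      (haveI : Algebra.IsQuadraticExtension ℚ K := ⟨hK.1⟩; absGaloisQuot ℚ K σ ≠ 1) ∧ (∀ P, F (σ • P) = -(σ • F P))) :
    ∃ P₀ s₀ : (W.baseChange K).toAffine.Point,
      Affine.Point.map (W' := W) (algebraMap K (ringClassField K ι 1)).toRatAlgHom P₀ = d₁.derivedPoint ∧
      IsOfFinAddOrder s₀ ∧ τ • s₀ = s₀ ∧ τ • (P₀ - s₀) = -(P₀ - s₀) ∧
      (¬ ∃ Q : (W.baseChange K).toAffine.Point, (2 : ℤ) • Q = P₀ - s₀) ∧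
      ∃ (x y : ℚ) (hxy : (W.quadraticTwist (discr K : ℚ)).toAffine.Nonsingular x y),
        F (toGeomPoints _ (.some x y hxy)) = Affine.Point.map (W' := W) (absEmbedding ℚ K) (P₀ - s₀) ∧
        OnEgg (W.quadraticTwist (discr K : ℚ)) x := by
  -- adapted from `…NegDiscNarrowDepthZeroReductionBitOfK1.reductionBit_of_not_two_dvd_derivedPoint_prime` (gk2-p4 g25)
  have h2 : Module.finrank ℚ K = 2 := hK.1
  haveI : Algebra.IsQuadraticExtension ℚ K := ⟨h2⟩
  haveI : IsGalois ℚ K := inferInstance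
  have hcard : Nat.card (K ≃ₐ[ℚ] K) = 2 := by rw [IsGalois.card_aut_eq_finrank, h2]
  -- `d_K · Δ_E < 0` is not a square
  have hsq : ¬ IsSquare ((NumberField.discr K : ℚ) * W.Δ) := by
    rintro ⟨r, hr⟩
    have hneg : (NumberField.discr K : ℚ) * W.Δ < 0 :=
      mul_neg_of_neg_of_pos (by exact_mod_cast IsImaginaryQuadratic.discr_neg hK) hpos
    rw [hr] at hneg
    exact absurd hneg (not_lt.mpr (mul_self_nonneg r))
  -- `E(K[1])[2] = 0`, hence `E(K)[2] = 0`
  have htors : ∀ T : (W.baseChange (ringClassField K ι 1)).toAffine.Point, (2 : ℤ) • T = 0 → T = 0 := by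
    intro T hT
    have h := GenusExact.torsionBy_two_ringClassField_eq_bot W hK ι one_ne_zero hs2 hsq
    have hT' : T ∈ AddSubgroup.torsionBy (W.baseChange (ringClassField K ι 1)).toAffine.Point ((2 : ℕ) : ℤ) :=
      (Submodule.mem_torsionBy_iff _ T).mpr (by exact_mod_cast hT)
    rw [h] at hT'
    exact (AddSubgroup.mem_bot).mp hT'
  set i : (W.baseChange K).toAffine.Point →+ (W.baseChange (ringClassField K ι 1)).toAffine.Point :=
    Affine.Point.map (W' := W) (algebraMap K (ringClassField K ι 1)).toRatAlgHom with hi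
  have hiinj : Function.Injective i := Affine.Point.map_injective (W' := W) _
  have h2K0 : ∀ T : (W.baseChange K).toAffine.Point, (2 : ℤ) • T = 0 → T = 0 := by
    intro T hT
    apply hiinj
    rw [map_zero]
    exact htors _ (by rw [← map_zsmul, hT, map_zero])
  -- `P₀ ∈ E(K)` over `P(1)`; Gross 5.3 with `w = +1`: `t₀ = τP₀ + P₀` is torsion, of odd order
  obtain ⟨P₀, hP₀H, hP₀⟩ := heegnerSystem_exists_isHeegnerPoint_map_eq_derivedPoint_one
    (heegnerPointOfConductor_one_galoisConj_holds (W.conductorNorm ℤ) W K) hK hH d₁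
  have hττ : τ * τ = 1 := by
    rcases Literature.NumberTheory.QuadraticFields.eq_one_or_eq_of_card_eq_two hcard hτ (τ * τ) with h | h
    · exact h
    · exact absurd (mul_left_cancel (a := τ) (h.trans (mul_one τ).symm)) hτ
  have hσ : (τ : K →ₐ[ℚ] K) ≠ AlgHom.id ℚ K := fun h ↦ hτ (AlgEquiv.ext fun x ↦ DFunLike.congr_fun h x)
  set t₀ : (W.baseChange K).toAffine.Point := τ • P₀ + P₀ with ht₀
  have ht₀fin : IsOfFinAddOrder t₀ := by
    have h := heegnerPoint_conj_add_rootNumber_smul.apply heegnerPoint_conj_add_rootNumber_smul_holds hK hH hP₀H hσ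
    rwa [hw, one_smul, ← WeierstrassCurve.smul_def W K τ P₀] at h
  have hτt₀ : τ • t₀ = t₀ := by
    rw [ht₀, smul_add, ← mul_smul, hττ, one_smul, add_comm]
  have hodd' : Odd (addOrderOf t₀) := DepthZero.odd_addOrderOf_of_two_torsionFree ht₀fin fun k hk ↦ h2K0 _ hk
  obtain ⟨m', hm'⟩ := hodd'
  -- the torsion correction `s₀ = ((m+1)/2)·t₀`: `2s₀ = t₀`, `τs₀ = s₀`
  set c : ℤ := (m' : ℤ) + 1 with hc
  set s₀ : (W.baseChange K).toAffine.Point := c • t₀ with hs₀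
  have hs₀fin : IsOfFinAddOrder s₀ := ht₀fin.zsmul
  have h2s₀ : (2 : ℤ) • s₀ = t₀ := by
    have hcm : (2 : ℤ) * c = (addOrderOf t₀ : ℤ) + 1 := by rw [hc, hm']; push_cast; ring
    rw [hs₀, smul_smul, hcm, add_zsmul, one_zsmul, natCast_zsmul, addOrderOf_nsmul_eq_zero, zero_add]
  have hsm : τ • (c • t₀) = c • (τ • t₀) :=
    map_zsmul (DistribSMul.toAddMonoidHom ((W.baseChange K).toAffine.Point) τ) c t₀
  have hτs₀ : τ • s₀ = s₀ := by rw [hs₀, hsm, hτt₀]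
  -- the anti-invariant point `Y = P₀ − s₀` has no half in `E(K)` (else `y_K ∈ 2E(K[1])`)
  have hanti : τ • (P₀ - s₀) = -(P₀ - s₀) := by
    have hτP : τ • P₀ = -P₀ + t₀ := by rw [ht₀]; abel
    rw [smul_sub, hτs₀, hτP, ← h2s₀, two_zsmul]
    abel
  have hY2 : ¬ ∃ Q : (W.baseChange K).toAffine.Point, (2 : ℤ) • Q = P₀ - s₀ := by
    rintro ⟨Q, hQ⟩
    apply hK1
    refine ⟨i (Q + c • s₀), ?_⟩
    rw [← map_zsmul, ← hP₀]
    change i ((2 : ℤ) • (Q + c • s₀)) = i P₀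
    congr 1
    have : (2 : ℤ) • (c • s₀) = s₀ := by rw [smul_comm, h2s₀]
    rw [zsmul_add, hQ, this, sub_add_cancel]
  -- §2: the twin point of `Y` lies on the egg
  obtain ⟨x, y, hxy, hz, hegg⟩ := exists_twin_point_onEgg_of_anti_of_not_exists_two_smul W hs2 hTam h1 hK hodd hH h2K hpos hτ
    Cd hCd hDEF F hF hanti hY2
  exact ⟨P₀, s₀, hP₀, hs₀fin, hτs₀, hanti, hY2, x, y, hxy, hz, hegg⟩

omit [W.IsGloballyMinimal] in
/-- **`1 ≤ M₀` ⟹ the twin Heegner point lies OFF the egg** (converse of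
`exists_twinHeegnerPoint_onEgg_of_not_two_dvd_derivedPoint`, for ANY lift `P₀ ↦ P(1)` and any torsion `s₀` with `P₀ − s₀`
anti-invariant): if `y_K = P(1) ∈ 2E(K[1])` then `P₀ ∈ 2E(K)` by McCallum's descent (`E(K[1])[2] = 0`), `s₀ ∈ 2E(K)` (odd order, as
`E(K)[2] = 0`), so `Y = P₀ − s₀ ∈ 2E(K)` and §3 applies.  Together: «`M₀ = 0` ⟺ the twin Heegner point lies on the egg of `E^{(d_K)}`».
[cite: McCallumLMS1991, §5 Lemma 5.1 (p. 303)] [cite: GrossLMS1991, §4 Lemma 4.3] [cite: Kramer1981, §2 Prop. 6 (p. 127)] -/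
theorem not_onEgg_twinHeegnerPoint_of_two_dvd_derivedPoint {K : Type} [Field K] [NumberField K]
    [(W.quadraticTwist (discr K : ℚ)).IsElliptic]
    (hpos : 0 < W.Δ) (hs2 : W.HasSurjectiveModNGaloisRep 2) (hK : IsImaginaryQuadratic K) {τ : K ≃ₐ[ℚ] K} (hτ : τ ≠ 1)
    (Dt : ModularParametrizationData W (W.conductorNorm ℤ)) (β : ℤ) (ι : K →+* ℂ) (d₁ : KolyvaginHeegnerData Dt β ι 1)
    (hdiv : ∃ Q : (W.baseChange (ringClassField K ι 1)).toAffine.Point, (2 : ℤ) • Q = d₁.derivedPoint)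
    (F : (W.quadraticTwist (discr K : ℚ)).geomPoints ≃+ W.geomPoints)
    (hF : ∀ σ : absoluteGaloisGroup ℚ,
      (haveI : Algebra.IsQuadraticExtension ℚ K := ⟨hK.1⟩; absGaloisQuot ℚ K σ = 1) ∧ (∀ P, F (σ • P) = σ • F P) ∨
      (haveI : Algebra.IsQuadraticExtension ℚ K := ⟨hK.1⟩; absGaloisQuot ℚ K σ ≠ 1) ∧ (∀ P, F (σ • P) = -(σ • F P)))
    {P₀ s₀ : (W.baseChange K).toAffine.Point}
    (hP₀ : Affine.Point.map (W' := W) (algebraMap K (ringClassField K ι 1)).toRatAlgHom P₀ = d₁.derivedPoint)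
    (hs₀fin : IsOfFinAddOrder s₀) (hanti : τ • (P₀ - s₀) = -(P₀ - s₀))
    {x y : ℚ} {hxy : (W.quadraticTwist (discr K : ℚ)).toAffine.Nonsingular x y}
    (hz : F (toGeomPoints _ (.some x y hxy)) = Affine.Point.map (W' := W) (absEmbedding ℚ K) (P₀ - s₀)) :
    ¬ OnEgg (W.quadraticTwist (discr K : ℚ)) x := by
  -- `d_K · Δ_E < 0` is not a square; `E(K[1])[2] = 0`, hence `E(K)[2] = 0`
  have hsq : ¬ IsSquare ((NumberField.discr K : ℚ) * W.Δ) := by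
    rintro ⟨r, hr⟩
    have hneg : (NumberField.discr K : ℚ) * W.Δ < 0 :=
      mul_neg_of_neg_of_pos (by exact_mod_cast IsImaginaryQuadratic.discr_neg hK) hpos
    rw [hr] at hneg
    exact absurd hneg (not_lt.mpr (mul_self_nonneg r))
  have htors : ∀ T : (W.baseChange (ringClassField K ι 1)).toAffine.Point, (2 : ℤ) • T = 0 → T = 0 := by
    intro T hT
    have h := GenusExact.torsionBy_two_ringClassField_eq_bot W hK ι one_ne_zero hs2 hsq
    have hT' : T ∈ AddSubgroup.torsionBy (W.baseChange (ringClassField K ι 1)).toAffine.Point ((2 : ℕ) : ℤ) :=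
      (Submodule.mem_torsionBy_iff _ T).mpr (by exact_mod_cast hT)
    rw [h] at hT'
    exact (AddSubgroup.mem_bot).mp hT'
  have hiinj : Function.Injective (Affine.Point.map (W' := W) (algebraMap K (ringClassField K ι 1)).toRatAlgHom) :=
    Affine.Point.map_injective (W' := W) _
  have h2K0 : ∀ T : (W.baseChange K).toAffine.Point, (2 : ℤ) • T = 0 → T = 0 := by
    intro T hT
    apply hiinj
    rw [map_zero]
    exact htors _ (by rw [← map_zsmul, hT, map_zero])
  -- McCallum descent: `P₀ ∈ 2E(K)`
  obtain ⟨Q₀, hQ₀⟩ : ∃ Q₀ : (W.baseChange K).toAffine.Point, (2 : ℤ) ^ 1 • Q₀ = P₀ :=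
    (McCallum1991.exists_pow_smul_eq_derivedPoint_one_iff hK d₁ (p := 2) htors hP₀ 1).mp
      (by rw [pow_one]; exact hdiv)
  rw [pow_one] at hQ₀
  -- `s₀ ∈ 2E(K)`: odd order
  obtain ⟨m', hm'⟩ := DepthZero.odd_addOrderOf_of_two_torsionFree hs₀fin fun k hk ↦ h2K0 _ hk
  have h2s : (2 : ℤ) • (((m' : ℤ) + 1) • s₀) = s₀ := by
    have hcm : (2 : ℤ) * ((m' : ℤ) + 1) = (addOrderOf s₀ : ℤ) + 1 := by rw [hm']; push_cast; ring
    rw [smul_smul, hcm, add_zsmul, one_zsmul, natCast_zsmul, addOrderOf_nsmul_eq_zero, zero_add]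
  -- `Y = P₀ − s₀ = 2 (Q₀ − (m'+1) s₀)`; §3
  have hQY : (2 : ℤ) • (Q₀ - ((m' : ℤ) + 1) • s₀) = P₀ - s₀ := by rw [zsmul_sub, hQ₀, h2s]
  exact not_onEgg_twin_point_of_two_smul_eq W hK hτ h2K0 F hF hanti hQY hz

end Heegner

end Summit.BirchSwinnertonDyer.BirchSwinnertonDyer.Theorems.GenusSupplyNarrow.ArchBit
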